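import Literature.AnabelianGeometry.EtaleTheta.TemperedFrobenioidOfBaseFieldHull
import Literature.AnabelianGeometry.EtaleTheta.Discharge.Sec5OfThetaSetting
import Literature.AnabelianGeometry.EtaleTheta.Discharge.Sec3Thm37Standard
import Literature.AnabelianGeometry.EtaleTheta.BiKummerThm44SubModelConnectedBaseInj
import Literature.AnabelianGeometry.SemiGraphs.TemperedOpenMapping
import HarnessLib

/-!
# [EtTh] §5 p.322: the base-field-theoretic hull over `B^temp(Π^tp_X̲̲)⁰` OF THE §1 SETTING — the §4/§5 bi-Kummer setting with
# `A_⊙^bs := Ÿ̲̲` at a tempered Frobenioid whose constants are genuine (`ℚ̄_p`, Galois action through the augmentation); class (b)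

S. Mochizuki, *The étale theta function …*, Publ. RIMS **45** (2009) [MochizukiEtTh2009], §5 p.322 (PDF p.96): «we return to the
situation of Example 3.9 … '`A`' is one of the smooth log orbicurves `X̲^log; C̲^log; X̲̲^log; C̲̲^log` [each of which is geometrically
connected over the field `K = K̈`] … the divisor monoid `Φ` on `D = D_α` determines a tempered Frobenioid `C` of monoid type `ℤ` over the
base category `D`»; Def. 3.6 (iii)/(iv) p.304 (PDF p.78) (the constants `K` and the base-field-theoretic hull); Def. 4.1 p.312 (PDF p.86)
(the bi-Kummer setting); [SemiAnbd] Ex. 3.10 p.43 (`Π^tp_X ↠ G_K` of a tempered group: open).  [cite: MochizukiEtTh2009, §5 p.322 (PDF p.96)]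

abc-iut cell, layer L2, seat abc-iut-L2-d3 (gen 10); L2-lead ruling R1112 «CONST-DICT CARRIER = C^{bs-fld} HULL OVER THE GENUINE
BASE».  CLASS (b) CONSTRUCTION (defs + one-liners; nothing landed is edited), pinning this lineage's generic hull
`BsFldHull.temperedFrobenioid` (`TemperedFrobenioidOfBaseFieldHull.lean`) to the §1 SETTING exactly as abc-iut-L2-t4 pinned the §5
data (`Discharge/Sec5OfThetaSetting.lean`, `mkOfThetaSettingYdd`):
* `augHuu C : Π^tp_X̲̲ = C.Huu → G_{ℚ_p}` — the augmentation of the Setting restricted to abc-iut-L2-t8's open subgroup `Π^tp_X̲̲` (image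
  `G_K`: `map_augHuu_top`); **its open subgroups have open images** (`isOpen_map_augHuu`) by the OPEN MAPPING THEOREM FOR TEMPERED
  GROUPS (abc-iut-w5-d111's `TemperedCurve.isOpenMap_aug_of_groupLevelData`, from the §6 parameter bundle `e : GroupLevelData` —
  «`Π^temp` tempered, Galois-countable»); every base field `K_U` of the hull contains `K` (`K_le_fixFld`);
* `BsFldHull.idx_eq_ramIdx` — the index `e_U` of part 1 IS the absolute ramification index of `K_U` (ref-d D21 INFO-1);
* `BsFldHull.isMonoidOn_ratFnFunctor` / `BsFldHull.hypotheses` (generic `Γ`, `a`): «`B` is a monoid on `D`» and the [FrdI] Thm. 5.2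
  standing hypotheses `ModelFrobenioid.Hypotheses` — the `h` slot of abc-iut-L2-t4's §5 data — HOLD at the hull (abc-iut-w5-d179's
  `isMonoidOn_ratFnFunctor_connectedPart_of_baseInj` from `hBD`, abc-iut-L2-t3's `hypotheses_treeCatVocab`);
* **`hullFrd C e R S`** — the base-field-theoretic hull as a tempered Frobenioid of monoid type `ℤ` over
  `B^temp(Π^tp_X̲̲)⁰ = ConnectedPart (BTemp (C.temperedArithmeticGroup e).Pi)` (`= BsFldHull.temperedFrobenioid p (augHuu C) …
  (C.temperedArithmeticGroup e).isTempered R S`), a Frobenioid (`isFrobenioid_hullFrd`), `Φ` perfect (`hP_hullFrd`), [FrdI] Thm. 5.2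
  hypotheses (`hypotheses_hullFrd`);
* **`hullSetting C e μ hC hS R S NH := BiKummerSetting.mkOfThetaSettingYdd C e μ hC hS (hullFrd C e R S) rfl (hP_hullFrd …) NH`** —
  abc-iut-L2-t4's §4/§5 setting OF THE SETTING (`A_⊙^bs := Ÿ̲̲`) AT THIS tempered Frobenioid: so `H_⊙ = Π^tp_Ÿ̲̲` on the nose
  (`mem_Hodot_hullSetting_iff`, abc-iut-L2-t4's theorem BY NAME) and every theorem of `Sec5OfConnectedTemperoid(Ydd…)` /
  `Sec5OfThetaSetting` applies to `hullSetting` by unification;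
* `nonempty_biKummerSetting_of_setting` — NON-VACUITY: for every theta setting with a `DoubleUnderline` datum and a §6 bundle, the §4
  interface over the genuine base `B^temp(Π^tp_X̲̲)⁰` is inhabited by a tempered Frobenioid with GENUINE constants.
WHAT THIS IS FOR (R1112): the carrier at which the {`hD` = `ConstantsDictionary`, `hconst`} column of the Lemma 5.8 / Thm 5.10 (ii)(iii)
nodes is to be DECIDED (sequel: the §5 junction data `θ := const`, roots, `K' := K`, `constEmb := ofFixed`, and the dictionary laws).
HONEST LABEL: genuine base / constants / Galois action; DEGENERATE divisor geometry (Θ̈ would be a constant) — not the tempered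
Frobenioid of the Tate curve; no `ThetaSetting` is asserted to exist; no instance, no notation, no `Prop`-valued definition, no sorry;
nothing here bears on [IUTchIII] Cor. 3.12; no side taken; typed ≠ proved elsewhere.
-/

noncomputable section

namespace Literature.AnabelianGeometry.EtaleTheta

open CategoryTheory Opposite Literature.AlgebraicGeometry.Frobenioids Literature.AnabelianGeometry.SemiGraphs

/-! ## The index `e_U` is the ramification index; [FrdI] Thm. 5.2 standing hypotheses at the generic hull -/

namespace BsFldHull

variable (p : ℕ) [Fact p.Prime] {Γ : Type} [Group Γ] [TopologicalSpace Γ] (a : Γ →* GQp p)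
  (ha : ∀ U : OpenSubgroup Γ, IsOpen ((U.toSubgroup.map a : Subgroup (GQp p)) : Set (GQp p)))

/-- **`e_U = e(K_U/ℚ_p)`**: the index `idx` of part 1 (chosen through `exists_idx`) IS the absolute ramification index `ramIdx (fixFld a U)`
(both generate the value group `ord(K_U^×) = (1/e)ℤ`; ref-d D21 INFO-1 asked for this identification in the kernel).
[cite: MochizukiFrdII2008, Ex 1.1 (i) p.7] -/
theorem idx_eq_ramIdx (U : OpenSubgroup Γ) :
    idx p a ha U = @ramIdx p _ (fixFld p a U) (finiteDimensional_fixFld p a ha U) := by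
  haveI := finiteDimensional_fixFld p a ha U
  obtain ⟨x, hx, hx0, hordx⟩ := exists_mem_fixFld_ordFun_eq p a ha U 1
  obtain ⟨m, hm⟩ := exists_ordFun_coe_eq p (fixFld p a U) ⟨x, hx⟩ (fun h => hx0 (congrArg Subtype.val h))
  obtain ⟨g, hg⟩ := exists_unit_ordFun_eq p (fixFld p a U) 1
  obtain ⟨m', hm'⟩ := exists_ordFun_eq_of_mem_fixFld p a ha U (g : fixFld p a U).2 (by exact_mod_cast g.ne_zero)
  have he : (0 : ℚ) < idx p a ha U := by exact_mod_cast idx_pos p a ha U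
  have he' : (0 : ℚ) < ramIdx p (fixFld p a U) := by exact_mod_cast ramIdx_pos p (fixFld p a U)
  -- `1/e = m/e'` and `1/e' = m'/e`
  have h1 : (1 : ℚ) / idx p a ha U = m / ramIdx p (fixFld p a U) := by
    have h := hordx.symm.trans hm
    simpa using h
  have h2 : (1 : ℚ) / ramIdx p (fixFld p a U) = m' / idx p a ha U := by
    have h := hg.symm.trans hm'
    simpa using h
  have k1 : (ramIdx p (fixFld p a U) : ℚ) = m * idx p a ha U := by
    field_simp at h1; linarith [h1]
  have k2 : (idx p a ha U : ℚ) = m' * ramIdx p (fixFld p a U) := by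
    field_simp at h2; linarith [h2]
  have hm0 : (0 : ℚ) < m := by
    have := he'; rw [k1] at this; exact pos_of_mul_pos_left this he.le
  have hm'0 : (0 : ℚ) < m' := by
    have := he; rw [k2] at this; exact pos_of_mul_pos_left this he'.le
  have hmm : (m : ℚ) * m' = 1 := by
    have h3 : (idx p a ha U : ℚ) = m' * m * idx p a ha U := by
      conv_lhs => rw [k2, k1]
      ring
    have h4 : (m' : ℚ) * m = 1 := by
      have := mul_right_cancel₀ he.ne' (show (1 : ℚ) * idx p a ha U = m' * m * idx p a ha U by rw [one_mul]; exact h3)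
      exact this.symm
    rw [mul_comm]; exact h4
  have hm1 : (m : ℚ) = 1 := by
    have hmz : (0 : ℤ) < m := by exact_mod_cast hm0
    have hm'z : (0 : ℤ) < m' := by exact_mod_cast hm'0
    have hmmz : m * m' = 1 := by exact_mod_cast hmm
    have := Int.eq_one_of_mul_eq_one_right hmz.le hmmz
    exact_mod_cast this
  have : (ramIdx p (fixFld p a U) : ℚ) = idx p a ha U := by rw [k1, hm1, one_mul]
  exact_mod_cast this.symm

variable [IsTopologicalGroup Γ] (hΓ : IsTempered Γ) (R S : ((ConnectedPart (BTemp Γ))ᵒᵖ ⥤ CommMonCat.{0}) → Prop)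

/-- **«`B` is a monoid on `D`» at the hull** ([FrdI] Def. 1.1 (ii); abc-iut-w5-d179's `isMonoidOn_ratFnFunctor_connectedPart_of_baseInj`
from this lineage's `hBD`). [cite: MochizukiEtTh2009, Def 3.6 p.303 (PDF p.77)] -/
theorem isMonoidOn_ratFnFunctor : IsMonoidOn (temperedFrobenioid p a ha hΓ R S).ratFnFunctor :=
  (temperedFrobenioid p a ha hΓ R S).isMonoidOn_ratFnFunctor_connectedPart_of_baseInj fun α => hBD p a ha hΓ R S α

/-- **The [FrdI] Thm. 5.2 standing hypotheses HOLD at the hull** — the `h` slot of the §5 data (abc-iut-L2-t3's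
`hypotheses_treeCatVocab`). [cite: MochizukiFrdI2008, Thm. 5.2 p.100] -/
theorem hypotheses : ModelFrobenioid.Hypotheses (temperedFrobenioid p a ha hΓ R S).divisorMonoid (temperedFrobenioid p a ha hΓ R S).ratFnFunctor :=
  (temperedFrobenioid p a ha hΓ R S).hypotheses_treeCatVocab (isMonoidOn_ratFnFunctor p a ha hΓ R S)

end BsFldHull

namespace ThetaSetting.EtaleThetaData.DoubleUnderline

variable {p : ℕ} [Fact p.Prime] {D : ThetaSetting p} {E : D.EtaleThetaData} {l : ℕ} (C : E.DoubleUnderline l)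

/-! ## The augmentation of `Π^tp_X̲̲` into `G_{ℚ_p}` and its openness -/

/-- **`a := (Π^tp_X̲̲ ⊆ Π^tp_X ↠ G_K ≤ G_{ℚ_p})`**, the augmentation of the Setting restricted to `Π^tp_X̲̲ = C.Huu` («geometrically connected
over `K`», §5 p.322). [cite: MochizukiEtTh2009, §5 p.322 (PDF p.96)] -/
def augHuu : C.Huu →* GQp p := D.aug.toMonoidHom.comp C.Huu.subtype

/-- `augHuu` on elements. [cite: MochizukiEtTh2009, §5 p.322 (PDF p.96)] -/
@[simp] theorem augHuu_apply (g : C.Huu) : C.augHuu g = D.aug (g : D.PiTemp) := rfl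

/-- The image of `Π^tp_X̲̲` is `G_K` (abc-iut-L2-t8's `map_aug_Huu`). [cite: MochizukiEtTh2009, Prop 2.2 (iii) p.297 (PDF p.37)] -/
theorem map_augHuu_top : (⊤ : Subgroup C.Huu).map C.augHuu = D.GK := by
  rw [augHuu, ← Subgroup.map_map, ← MonoidHom.range_eq_map, Subgroup.range_subtype]
  exact C.map_aug_Huu

/-- **Open subgroups of `Π^tp_X̲̲` have OPEN images in `G_{ℚ_p}`** — `Π^tp_X ↠ G_K` is an open map (open mapping theorem for tempered
groups, abc-iut-w5-d111, from the §6 bundle `e`) and `Π^tp_X̲̲ ⊆ Π^tp_X` is open. [cite: MochizukiSemiAnbd2006, Ex 3.10 p.43] -/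
theorem isOpen_map_augHuu (e : D.toTemperedCurve.GroupLevelData) (U : OpenSubgroup C.Huu) :
    IsOpen ((U.toSubgroup.map C.augHuu : Subgroup (GQp p)) : Set (GQp p)) := by
  have h1 : IsOpenMap (fun g : C.Huu => (g : D.PiTemp)) := C.isOpen_Huu.isOpenMap_subtype_val
  have h2 : IsOpenMap D.aug := D.toTemperedCurve.isOpenMap_aug_of_groupLevelData e
  have hset : ((U.toSubgroup.map C.augHuu : Subgroup (GQp p)) : Set (GQp p)) =
      D.aug '' ((fun g : C.Huu => (g : D.PiTemp)) '' (U : Set C.Huu)) := by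
    rw [Subgroup.coe_map, Set.image_image]
    rfl
  rw [hset]
  exact h2 _ (h1 _ U.isOpen)

/-- **Every base field of the hull contains `K`**: `K ⊆ K_U = ℚ̄_p^{a(U)}` for `U ⊆ Π^tp_X̲̲` open (`a(U) ⊆ G_K` fixes `K`).
[cite: MochizukiEtTh2009, §5 p.322 (PDF p.96)] -/
theorem K_le_fixFld (U : OpenSubgroup C.Huu) : D.K ≤ BsFldHull.fixFld p C.augHuu U := by
  intro x hx
  rw [BsFldHull.mem_fixFld_iff]
  intro u _
  have hu : C.augHuu u ∈ D.GK := D.aug_mem_GK _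
  exact (IntermediateField.mem_fixingSubgroup_iff _ _).mp hu x hx

/-! ## The hull as a tempered Frobenioid over `B^temp(Π^tp_X̲̲)⁰` -/

variable (e : D.toTemperedCurve.GroupLevelData) (R S : ((ConnectedPart (BTemp (C.temperedArithmeticGroup e).Pi))ᵒᵖ ⥤ CommMonCat.{0}) → Prop)

/-- **The base-field-theoretic hull of the Setting** as a tempered Frobenioid of monoid type `ℤ` over
`B^temp(Π^tp_X̲̲)⁰ = ConnectedPart (BTemp (C.temperedArithmeticGroup e).Pi)` (this lineage's generic `BsFldHull.temperedFrobenioid` at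
`a := augHuu C`, `ha := isOpen_map_augHuu C e`, `hΓ := (C.temperedArithmeticGroup e).isTempered`).  [cite: MochizukiEtTh2009, §5 p.322 (PDF p.96)] -/
def hullFrd :
    TemperedFrobenioid (RealifiedDivisorMonoids.ofRlfZWeak (DivisorMonoids.bsFldHull p C.augHuu (C.isOpen_map_augHuu e))
      (BsFldHull.hpf p C.augHuu (C.isOpen_map_augHuu e))) (ConnectedPart (BTemp (C.temperedArithmeticGroup e).Pi))
      (treeCatVocab (ConnectedPart (BTemp (C.temperedArithmeticGroup e).Pi)) R S) :=
  BsFldHull.temperedFrobenioid p C.augHuu (C.isOpen_map_augHuu e) (C.temperedArithmeticGroup e).isTempered R S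

/-- `hullFrd` IS the generic hull (definitionally). [cite: MochizukiEtTh2009, §5 p.322 (PDF p.96)] -/
theorem hullFrd_eq : C.hullFrd e R S =
    BsFldHull.temperedFrobenioid p C.augHuu (C.isOpen_map_augHuu e) (C.temperedArithmeticGroup e).isTempered R S := rfl

/-- Monoid type `ℤ` ("a tempered Frobenioid `C` of monoid type `ℤ`", p.322). [cite: MochizukiEtTh2009, §5 p.322 (PDF p.96)] -/
theorem hullFrd_monoidType : (C.hullFrd e R S).monoidType = MonoidType.Z := rfl

/-- `Φ(A)` is perfect (the `hP` slot). [cite: MochizukiEtTh2009, Def 4.1 p.312 (PDF p.86)] -/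
theorem hP_hullFrd (A : (ConnectedPart (BTemp (C.temperedArithmeticGroup e).Pi))ᵒᵖ) : IsPerfect ((C.hullFrd e R S).Φ.carrier A) :=
  BsFldHull.hP p C.augHuu (C.isOpen_map_augHuu e) (C.temperedArithmeticGroup e).isTempered R S A

/-- The hull of the Setting IS a Frobenioid ([FrdI] Thm. 5.2 (ii)). [cite: MochizukiFrdI2008, Thm. 5.2 (ii) p.100] -/
theorem isFrobenioid_hullFrd : PreFrobenioid.IsFrobenioid (C.hullFrd e R S).toElem :=
  BsFldHull.isFrobenioid_temperedFrobenioid p C.augHuu (C.isOpen_map_augHuu e) (C.temperedArithmeticGroup e).isTempered R S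

/-- **The [FrdI] Thm. 5.2 hypotheses at the hull of the Setting** (the `h` slot of `ThetaFrobenioid.ofThetaSettingData`).
[cite: MochizukiFrdI2008, Thm. 5.2 p.100] -/
theorem hypotheses_hullFrd : ModelFrobenioid.Hypotheses (C.hullFrd e R S).divisorMonoid (C.hullFrd e R S).ratFnFunctor :=
  BsFldHull.hypotheses p C.augHuu (C.isOpen_map_augHuu e) (C.temperedArithmeticGroup e).isTempered R S

/-! ## The §4/§5 setting of the Setting at the hull (`A_⊙^bs := Ÿ̲̲`) -/

variable {N : ℕ+} (μ : D.CyclotomeMod l N) (hC : D.Compat) (hS : D.Sec2Hyps)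
  (NH : Subgroup (Field.absoluteGaloisGroup D.K) → (C.hullFrd e R S).category → ℕ+ → Prop)

/-- **The §4/§5 bi-Kummer setting OF THE SETTING at the base-field-theoretic hull** (abc-iut-L2-t4's `mkOfThetaSettingYdd`:
`A_⊙ := (Π^tp_X̲̲/Π^tp_Ÿ̲̲, 0)`, Galois objects / surjections of `B^temp(Π^tp_X̲̲)⁰`).  [cite: MochizukiEtTh2009, Def 4.1 p.312 (PDF p.86); §5 p.322 (PDF p.96)] -/
def hullSetting : BiKummerSetting (C.temperedArithmeticGroup e)
    (RealifiedDivisorMonoids.ofRlfZWeak (DivisorMonoids.bsFldHull p C.augHuu (C.isOpen_map_augHuu e))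
      (BsFldHull.hpf p C.augHuu (C.isOpen_map_augHuu e)))
    (ConnectedPart (BTemp (C.temperedArithmeticGroup e).Pi)) (treeCatVocab (ConnectedPart (BTemp (C.temperedArithmeticGroup e).Pi)) R S) :=
  BiKummerSetting.mkOfThetaSettingYdd C e μ hC hS (C.hullFrd e R S) rfl (C.hP_hullFrd e R S) NH

/-- `hullSetting` IS `mkOfThetaSettingYdd` at the hull (definitionally) — every theorem of abc-iut-L2-t4's `Sec5OfThetaSetting` /
`Sec5OfConnectedTemperoid` about `mkOfThetaSettingYdd` / `mkOfConnectedTemperoidYdd` applies.  [cite: MochizukiEtTh2009, §5 p.322 (PDF p.96)] -/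
theorem hullSetting_eq : C.hullSetting e R S μ hC hS NH =
    BiKummerSetting.mkOfThetaSettingYdd C e μ hC hS (C.hullFrd e R S) rfl (C.hP_hullFrd e R S) NH := rfl

/-- The tempered Frobenioid of `hullSetting` is the hull (definitionally). [cite: MochizukiEtTh2009, Def 4.1 p.312 (PDF p.86)] -/
theorem hullSetting_tf : (C.hullSetting e R S μ hC hS NH).tf = C.hullFrd e R S := rfl

/-- **`H_⊙ = Π^tp_Ÿ̲̲` on the nose** at the hull (abc-iut-L2-t4's `mem_Hodot_mkOfThetaSettingYdd_iff`).
[cite: MochizukiEtTh2009, Def 4.1 p.312 (PDF p.86); §5 p.322 (PDF p.96)] -/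
theorem mem_Hodot_hullSetting_iff (g : C.Huu) : g ∈ (C.hullSetting e R S μ hC hS NH).Hodot ↔ (g : D.PiTemp) ∈ D.GtpYdd :=
  BiKummerSetting.mem_Hodot_mkOfThetaSettingYdd_iff C e μ hC hS (C.hullFrd e R S) rfl (C.hP_hullFrd e R S) NH g

include μ hC hS NH in
/-- **NON-VACUITY of the §4 interface over the genuine base with genuine constants**: for every theta setting carrying a
`DoubleUnderline` datum and a §6 bundle, `BiKummerSetting (C.temperedArithmeticGroup e) T₀ (B^temp(Π^tp_X̲̲)⁰) VD` is inhabited at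
the base-field-theoretic hull.  [cite: MochizukiEtTh2009, Def 4.1 p.312 (PDF p.86)] -/
theorem nonempty_biKummerSetting_of_setting : Nonempty (BiKummerSetting (C.temperedArithmeticGroup e)
    (RealifiedDivisorMonoids.ofRlfZWeak (DivisorMonoids.bsFldHull p C.augHuu (C.isOpen_map_augHuu e))
      (BsFldHull.hpf p C.augHuu (C.isOpen_map_augHuu e)))
    (ConnectedPart (BTemp (C.temperedArithmeticGroup e).Pi)) (treeCatVocab (ConnectedPart (BTemp (C.temperedArithmeticGroup e).Pi)) R S)) :=
  ⟨C.hullSetting e R S μ hC hS NH⟩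

end ThetaSetting.EtaleThetaData.DoubleUnderline

end Literature.AnabelianGeometry.EtaleTheta

end
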